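import Summits.AtomisticToContinuum.HydrodynamicLimit.Theses.RelayRaceLocality
import Summits.AtomisticToContinuum.HydrodynamicLimit.Theorems.RelayRaceLocalityNearConstantShortTimeHLWindowTransfer
import Summits.AtomisticToContinuum.HydrodynamicLimit.Theorems.RelayRaceLocalityNearConstantShortTimeHLEntropyToLLN
import HarnessLib

/-!
# Line `Sketch` (card `fejer-isometry-window-transfer`) for crux `NearConstantShortTimeHL` (stmt-AtomisticToContinuum-12502) — skeleton v3

Continuation lead prover-line-stmt-AtomisticToContinuum-12502-c1-0 (2026-08-16). v3 = v2 of lead 0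
(`Cruxes/NearConstantShortTimeHL/Lines/Sketch.lean`) with the two LANDED stubs imported from the tree instead of
carried as local `sorry` twins:

* `stub_windowTransfer : KineticFluxLdDecayQuad → ExpWindowDecayQ` — `Theorems/RelayRaceLocalityNearConstantShortTimeHLWindowTransfer.lean` (p99138);
* `stub_entropyToLLN : NearConstantRelEntropy → NearConstantShortTimeHL` — `Theorems/RelayRaceLocalityNearConstantShortTimeHLEntropyToLLN.lean` (p100911);

so that the kernel certifies: the crux `NearConstantShortTimeHL` follows from the two remaining registered stubs
`stub_kineticInput : KineticFluxLdDecayQuad` (DELEGATED: re-typed shared crux stmt-10967, `@[conjecture]`) and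
`stub_nearConstantLedger : ExpWindowDecayQ → NearConstantRelEntropy` (the line's residue). Target (concluded BY NAME by
`NearConstantShortTimeHL_of`): `Summit.AtomisticToContinuum.HydrodynamicLimit.Theses.RelayRaceLocality.NearConstantShortTimeHL`.

The typed statements `ExpWindowDecayQ`, `NearConstantRelEntropy` are those of the landed files (namespace
`Summit.AtomisticToContinuum.HydrodynamicLimit.Theorems.NearConstantShortTimeHL`), byte-identical with v2.
-/

noncomputable section

namespace Summit.AtomisticToContinuum.HydrodynamicLimit.Theorems.NearConstantShortTimeHL

open Summit.AtomisticToContinuum.HydrodynamicLimit.Theses.RelayRaceLocality (NearConstantShortTimeHL)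
open Summit.AtomisticToContinuum.HydrodynamicLimit.Theorems.KineticWindowGronwallKineticClass (KineticFluxLdDecayQuad)

/-! ## Registered stubs still open -/

/-- **S1 (DELEGATED)** — the kinetic LD input in the consumable class: the re-typed shared crux stmt-10967
(`KineticFluxLdDecayQuad`, landed `@[conjecture]`, p83697). Not attacked inside this line. -/
theorem stub_kineticInput : KineticFluxLdDecayQuad := by
  sorry

/-- **S3 (LEAD; the line's residue)** — the near-constant Yau–Jaynes ledger with √h-Gronwall for general
`(ε_N, n_N)` families (card § Why it bites 4), from the window decay UNDER THE INVARIANT HOMOGENEOUS LAW. -/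
theorem stub_nearConstantLedger : ExpWindowDecayQ → NearConstantRelEntropy := by
  sorry

/-! ## Composition -/

/-- **The line closes the crux modulo its stubs**: `S4 (S3 (S2 S1))`, with S2 = `stub_windowTransfer` and
S4 = `stub_entropyToLLN` the landed theorems. -/
theorem NearConstantShortTimeHL_of : NearConstantShortTimeHL :=
  stub_entropyToLLN (stub_nearConstantLedger (stub_windowTransfer stub_kineticInput))

end Summit.AtomisticToContinuum.HydrodynamicLimit.Theorems.NearConstantShortTimeHL

end
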